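import Literature.NumberTheory.NumberFields.RayClassFieldAdicCharacterPrincipal
import Literature.NumberTheory.NumberFields.RayClassFieldAdicTowerArtinClasses
import HarnessLib

/-!
# The `v`-adic Artin character on TWISTED ARTIN LIFTS: `κ_𝔪(τ·g_{(β)})·β_v` is independent of the modulus `𝔪`, of the
# principal ideal `(β)` with `((β), K(𝔪)/K) = τ⁻¹|_{K(𝔪)}` and of the lift `g_{(β)}`, UP TO A GLOBAL UNIT
# (de Shalit 1987, II.4.7 (16) / II.4.12: the constant `U_τ` of the twisted class sums; Neukirch VI (7.1); part 5)

Sequel of `RayClassFieldAdicCharacterPrincipal.lean` (`κ(σ_(α)) = α_v⁻¹`) and `RayClassFieldAdicTowerArtinClasses.lean`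
(`(𝔞, K(𝔪)/K) = (𝔟, K(𝔪)/K) ⟺ 𝔞 ∼ 𝔟 mod 𝔪`).  Setting: `K` totally complex, `v` a finite prime, moduli `𝔪 ≠ 0` with
`v ∤ 𝔪`, `w_𝔪 = 1`; `κ_𝔪 = rayAdicCharacter : Gal(K̄/K(𝔪)) →* 𝒪_vˣ`.  For `τ ∈ Γ_K` FIXED, a level consists of such an `𝔪`,
an integer `β` prime to `𝔪v` whose Artin symbol on `K(𝔪)` is `τ⁻¹|_{K(𝔪)}`, and any `g ∈ Γ_K` restricting to
`((β), K(𝔪vⁿ)/K)` on the whole `v`-tower over `K(𝔪)` (e.g. the Artin lifts of the two-variable measure of II.4.14); then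
`τ·g ∈ Gal(K̄/K(𝔪))` and the local unit `κ_𝔪(τ·g)·β_v ∈ 𝒪_vˣ` is, UP TO THE IMAGE OF A GLOBAL UNIT `ζ ∈ 𝓞_Kˣ`, a constant
`U_τ` depending on `τ` alone — uniformly in every level `𝔪` below a reference modulus `𝔪₀` (`𝔪 ⊆ 𝔪₀`).  Class-field-theoretic
content: `τ ↔` an idèle class `[x]`, `g ↔ [ι(β)]`, `τg ∈ Kˣ·U_𝔪` ⟹ `κ(τg) = x_v/γ` with `(γ) = 𝔞_x·(β)`, `γ` unique up to
`𝓞_Kˣ` — here carried out inside the tree's `κ`-calculus: change of modulus (`rayAdicCharacter_eq_of_le`), the principal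
dictionary (`rayAdicCharacter_eq_integerUnit_inv`) and the ray-class criterion for equal Artin symbols
(`artinSymbol_eq_artinSymbol_iff_rayClassRel`).

* §1 helpers: `absRestrictNormalHom_eq_artinSymbol_of_le` (Artin data restrict down the tower), `rayAdicCharacter_eq_one_of_forall_mem_ker`
  (trivial on every layer ⟹ `κ = 1`), `exists_mul_sub_one_mem_and_not_mem` (an inverse mod `𝔪` outside `v`),
  `exists_unit_sub_mul_mem_of_artinSymbol_eq` (equal Artin symbols of `(β₀)`, `(β₁)` ⟹ `β₀ ≡ uβ₁ (mod 𝔪)`, `u ∈ 𝓞_Kˣ`),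
  `integerUnit_mul` / `integerUnit_one`;
* §2 ★★ `rayAdicCharacter_inv_mul_mul_integerUnit_eq` — **`κ_𝔪(g₀⁻¹g)·β₁,v·u_v = β₀,v`** for two Artin lifts agreeing on `K(𝔪)`;
* §3 ★★★ `exists_unit_forall_rayAdicCharacter_mul_integerUnit_eq` — **`∃ U_τ, ∀ levels (𝔪 ⊆ 𝔪₀, β, g), ∃ ζ ∈ 𝓞_Kˣ,
  κ_𝔪(τg)·β_v = ζ_v·U_τ`** (`h_K = 1` for the principal reference ideal), and its instance `…_of_sq` at the reference modulus
  `𝔪₀ = v̄²` of the lane of cell `bsd-print-cf2` (the hypothesis (U) = [I3] of the `j = 0` seam).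

Theorems only; no named fact, no instance, no `sorry`.

## References
* [deShalit1987] E. de Shalit, *Iwasawa theory of elliptic curves with complex multiplication* (1987), I.3.3 (9) (p. 18), II.1.7 (p. 41),
  II.4.7 (16) (p. 60), II.4.12 (p. 66–68), II.4.14 (38)–(40) (p. 71–72).
* [NeukirchANT1999] J. Neukirch, *Algebraic Number Theory* (1999), Ch. VI §1 Def. (1.7), Prop. (1.9), §7 Thm. (7.1).
-/

noncomputable section

open NumberField IsDedekindDomain IsDedekindDomain.HeightOneSpectrum Field
open scoped nonZeroDivisors Classical

namespace Literature.NumberTheory.NumberFields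

open Literature.NumberTheory.GaloisRepresentations Literature.NumberTheory.LFunctions Literature.NumberTheory.LFunctions.AbelianDensity

variable {K : Type} [Field K] [NumberField K]

/-! ### §1. Helpers -/

section Helpers

variable {v : HeightOneSpectrum (𝓞 K)}

/-- `α_v·β_v = (αβ)_v` in `𝒪_vˣ`. [cite: NeukirchANT1999, Ch. II §3 Prop. (3.8)] -/
theorem integerUnit_mul (v : HeightOneSpectrum (𝓞 K)) {α β : 𝓞 K} (hα : α ∉ v.asIdeal) (hβ : β ∉ v.asIdeal)
    (hαβ : α * β ∉ v.asIdeal) : integerUnit v (α * β) hαβ = integerUnit v α hα * integerUnit v β hβ := by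
  apply Units.ext
  apply Subtype.ext
  rw [Units.val_mul, MulMemClass.coe_mul, coe_integerUnit, coe_integerUnit, coe_integerUnit,
    show ((α * β : 𝓞 K) : K) = (α : K) * (β : K) by push_cast; rfl, HeightOneSpectrum.adicCompletion.coe_mul]

/-- `1_v = 1`. [cite: NeukirchANT1999, Ch. II §3 Prop. (3.8)] -/
theorem integerUnit_one (v : HeightOneSpectrum (𝓞 K)) (h : (1 : 𝓞 K) ∉ v.asIdeal) : integerUnit v 1 h = 1 := by
  apply Units.ext
  apply Subtype.ext
  rw [coe_integerUnit, Units.val_one, OneMemClass.coe_one, show ((1 : 𝓞 K) : K) = 1 by rfl,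
    HeightOneSpectrum.adicCompletion.coe_one]

omit [NumberField K] in
/-- A product avoids the prime `v` when its factors do. [folklore] -/
private theorem mul_not_mem {α β : 𝓞 K} (hα : α ∉ v.asIdeal) (hβ : β ∉ v.asIdeal) : α * β ∉ v.asIdeal :=
  fun h => (v.isPrime.mem_or_mem h).elim hα hβ

omit [NumberField K] in
/-- An element of a coprime principal ideal generator avoids `v` when `v ∣ 𝔪·?` — form used below: `IsCoprime ((β)) (𝔪·v) ⟹ β ∉ v`.
[cite: NeukirchANT1999, Ch. VI §1 Prop. (1.9)] -/
theorem not_mem_of_isCoprime_span_mul {𝔪 : Ideal (𝓞 K)} {β : 𝓞 K} (h : IsCoprime (Ideal.span {β}) (𝔪 * v.asIdeal)) :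
    β ∉ v.asIdeal := by
  intro hβ
  have h1 : IsCoprime (Ideal.span {β}) v.asIdeal := h.of_mul_right_right
  rw [Ideal.isCoprime_iff_sup_eq] at h1
  have : Ideal.span {β} ⊔ v.asIdeal ≤ v.asIdeal := sup_le ((Ideal.span_singleton_le_iff_mem _).mpr hβ) le_rfl
  exact v.isPrime.ne_top (top_le_iff.mp (h1 ▸ this))

omit [NumberField K] in
/-- Coprimality survives enlarging the second ideal. [folklore] -/
private theorem isCoprime_of_le {I J J' : Ideal (𝓞 K)} (h : IsCoprime I J) (hle : J ≤ J') : IsCoprime I J' := by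
  rw [Ideal.isCoprime_iff_sup_eq] at h ⊢
  exact top_le_iff.mp (h ▸ sup_le_sup_left hle I)

omit [NumberField K] in
/-- **An inverse modulo `𝔪` outside `v`**: for `(c)` prime to `𝔪` and `v ∤ 𝔪` there is `d ∉ v` with `dc ≡ 1 (mod 𝔪)`.
[cite: NeukirchANT1999, Ch. VI §1 Prop. (1.9)] -/
theorem exists_mul_sub_one_mem_and_not_mem {𝔪 : Ideal (𝓞 K)} (hv : ¬ 𝔪 ≤ v.asIdeal) {c : 𝓞 K}
    (hc : IsCoprime (Ideal.span {c}) 𝔪) : ∃ d : 𝓞 K, d * c - 1 ∈ 𝔪 ∧ d ∉ v.asIdeal := by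
  obtain ⟨x, hx, y, hy, hxy⟩ := Ideal.isCoprime_iff_exists.mp hc
  obtain ⟨d₀, rfl⟩ := Ideal.mem_span_singleton'.mp hx
  have hd₀ : d₀ * c - 1 ∈ 𝔪 := by
    rw [show d₀ * c - 1 = -y by linear_combination hxy]; exact 𝔪.neg_mem hy
  by_cases h0 : d₀ ∈ v.asIdeal
  · obtain ⟨m, hm𝔪, hmv⟩ := SetLike.not_le_iff_exists.mp hv
    refine ⟨d₀ + m, ?_, fun h => hmv ?_⟩
    · rw [show (d₀ + m) * c - 1 = (d₀ * c - 1) + m * c by ring]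
      exact 𝔪.add_mem hd₀ (𝔪.mul_mem_right _ hm𝔪)
    · simpa using v.asIdeal.sub_mem h h0
  · exact ⟨d₀, hd₀, h0⟩

variable [IsTotallyComplex K]

omit [IsTotallyComplex K] in
/-- **Artin data restrict down the tower**: if `σ|_{K(𝔐')} = ((β), K(𝔐')/K)` and `𝔐' ⊆ 𝔐` (`K(𝔐) ⊆ K(𝔐')`), then
`σ|_{K(𝔐)} = ((β), K(𝔐)/K)` — both restrictions of the universal Artin lift of `(β)`. [cite: NeukirchANT1999, Ch. VI §7 Thm. (7.1)] -/
theorem absRestrictNormalHom_eq_artinSymbol_of_le {𝔐 𝔐' : Ideal (𝓞 K)} (h𝔐' : 𝔐' ≠ ⊥) (h𝔐 : 𝔐 ≠ ⊥) (hle : 𝔐' ≤ 𝔐)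
    {β : 𝓞 K} (hβ0 : β ≠ 0) (hβc : IsCoprime (Ideal.span {β}) 𝔐') {σ : absoluteGaloisGroup K}
    (hσ : absRestrictNormalHom (rayClassField K 𝔐') σ = artinSymbol (galFrob K (rayClassField K 𝔐')) (Ideal.span {β})) :
    absRestrictNormalHom (rayClassField K 𝔐) σ = artinSymbol (galFrob K (rayClassField K 𝔐)) (Ideal.span {β}) := by
  have hβ0' : Ideal.span {β} ≠ ⊥ := by simpa [Ideal.span_singleton_eq_bot] using hβ0
  obtain ⟨σ₀, hσ₀⟩ := exists_forall_absRestrictNormalHom_eq_artinHom (K := K)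
    (toPrincipalIdeal (𝓞 K) K (Units.mk0 (β : K) (by exact_mod_cast hβ0)))
  have hmem' : toPrincipalIdeal (𝓞 K) K (Units.mk0 (β : K) (by exact_mod_cast hβ0)) ∈ idealsPrimeTo 𝔐' := by
    rw [toPrincipalIdeal_unitsMk0_coe hβ0]; exact unitsMk0_coeIdeal_mem_idealsPrimeTo h𝔐' hβ0' hβc
  have hmem : toPrincipalIdeal (𝓞 K) K (Units.mk0 (β : K) (by exact_mod_cast hβ0)) ∈ idealsPrimeTo 𝔐 := by
    rw [toPrincipalIdeal_unitsMk0_coe hβ0]; exact unitsMk0_coeIdeal_mem_idealsPrimeTo h𝔐 hβ0' (isCoprime_of_le hβc hle)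
  have e1 : absRestrictNormalHom (rayClassField K 𝔐') σ = absRestrictNormalHom (rayClassField K 𝔐') σ₀ := by
    rw [hσ, hσ₀ 𝔐' h𝔐' hmem', artinHom_toPrincipalIdeal_coe _ hβ0]
  rw [absRestrictNormalHom_eq_of_le (rayClassField_le_of_le h𝔐' hle) e1, hσ₀ 𝔐 h𝔐 hmem, artinHom_toPrincipalIdeal_coe _ hβ0]

variable {𝔪 : Ideal (𝓞 K)} (h𝔪 : 𝔪 ≠ ⊥) (hv : ¬ 𝔪 ≤ v.asIdeal) (hw : ∀ u : (𝓞 K)ˣ, (u : 𝓞 K) - 1 ∈ 𝔪 → u = 1)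

/-- **Trivial on every layer ⟹ `κ = 1`**: an element of `Gal(K̄/K(𝔪))` fixing every `K(𝔪vⁿ)` has `v`-adic Artin value `1`.
[cite: deShalit1987, I.3.3 (9) (p. 18), II.1.9 (p. 43)] -/
theorem rayAdicCharacter_eq_one_of_forall_mem_ker (σ : ↥(absRestrictNormalHom (rayClassField K 𝔪)).ker)
    (hσ : ∀ n : ℕ, (σ : absoluteGaloisGroup K) ∈ (absRestrictNormalHom (rayClassField K (𝔪 * v.asIdeal ^ n))).ker) :
    rayAdicCharacter h𝔪 hv hw σ = 1 :=
  rayAdicCharacter_eq_of_isAdicArtinValue h𝔪 hv hw fun n => by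
    rw [(MonoidHom.mem_ker).mp (hσ n), map_one, map_one, map_one, map_one]

/-- **Equal Artin symbols of principal ideals ⟹ generators congruent up to a unit**: for `β₀, β₁ ≠ 0` prime to `𝔪` with
`((β₀), K(𝔪)/K) = ((β₁), K(𝔪)/K)` there is `u ∈ 𝓞_Kˣ` with `β₀ ≡ uβ₁ (mod 𝔪)` (`(β₀) ∼ (β₁) mod 𝔪`: `c·β₁ = w·b·β₀`, `b ≡ c`).
[cite: NeukirchANT1999, Ch. VI §7 Thm. (7.1), Ch. VI §1 Def. (1.7)] -/
theorem exists_unit_sub_mul_mem_of_artinSymbol_eq (h𝔪 : 𝔪 ≠ ⊥) {β₀ β₁ : 𝓞 K} (hβ₀0 : β₀ ≠ 0) (hβ₀c : IsCoprime (Ideal.span {β₀}) 𝔪)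
    (hβ₁0 : β₁ ≠ 0) (hβ₁c : IsCoprime (Ideal.span {β₁}) 𝔪)
    (h : artinSymbol (galFrob K (rayClassField K 𝔪)) (Ideal.span {β₀}) = artinSymbol (galFrob K (rayClassField K 𝔪)) (Ideal.span {β₁})) :
    ∃ u : (𝓞 K)ˣ, β₀ - u * β₁ ∈ 𝔪 := by
  have hβ₀0' : Ideal.span {β₀} ≠ ⊥ := by simpa [Ideal.span_singleton_eq_bot] using hβ₀0
  have hβ₁0' : Ideal.span {β₁} ≠ ⊥ := by simpa [Ideal.span_singleton_eq_bot] using hβ₁0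
  rw [artinSymbol_eq_artinSymbol_iff_rayClassRel h𝔪 hβ₀0' hβ₀c hβ₁0' hβ₁c] at h
  obtain ⟨b, c, hb, hc, hccop, hbc, -, heq⟩ := h
  rw [Ideal.span_singleton_mul_span_singleton, Ideal.span_singleton_mul_span_singleton, Ideal.span_singleton_eq_span_singleton] at heq
  obtain ⟨w, hw'⟩ := heq
  -- `heq : c·β₁·w = b·β₀`; invert `c` modulo `𝔪`
  obtain ⟨x, hx, y, hy, hxy⟩ := Ideal.isCoprime_iff_exists.mp hccop
  obtain ⟨d, rfl⟩ := Ideal.mem_span_singleton'.mp hx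
  refine ⟨w, ?_⟩
  have e : β₀ - (w : 𝓞 K) * β₁ = y * β₀ - d * (b - c) * β₀ - y * ((w : 𝓞 K) * β₁) := by
    linear_combination -(β₀ - (w : 𝓞 K) * β₁) * hxy - d * hw'
  rw [e]
  exact 𝔪.sub_mem (𝔪.sub_mem (𝔪.mul_mem_right _ hy) (𝔪.mul_mem_right _ (𝔪.mul_mem_left _ hbc))) (𝔪.mul_mem_right _ hy)

end Helpers

/-! ### §2. Two Artin lifts agreeing on `K(𝔪)`: `κ_𝔪(g₀⁻¹g)·β₁,v = β₀,v` up to a global unit -/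

section Key

variable [IsTotallyComplex K] {v : HeightOneSpectrum (𝓞 K)} {𝔪 : Ideal (𝓞 K)}
  (h𝔪 : 𝔪 ≠ ⊥) (hv : ¬ 𝔪 ≤ v.asIdeal) (hw : ∀ u : (𝓞 K)ˣ, (u : 𝓞 K) - 1 ∈ 𝔪 → u = 1)

/-- ★★ **`κ_𝔪(g₀⁻¹g)·β₁,v·u_v = β₀,v`**: let `β₀, β₁ ≠ 0` be prime to `𝔪v` and `g₀, g ∈ Γ_K` restrict to `((β₀), K(𝔪vⁿ)/K)`,
`((β₁), K(𝔪vⁿ)/K)` on every layer; if `g₀|_{K(𝔪)} = g|_{K(𝔪)}` then `g₀⁻¹g ∈ Gal(K̄/K(𝔪))` and, for a global unit `u` with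
`β₀ ≡ uβ₁ (mod 𝔪)`, `κ_𝔪(g₀⁻¹g)·β₁,v·u_v = β₀,v` in `𝒪_vˣ`.  Proof: with `d β₀ ≡ 1 (mod 𝔪)`, `d ∉ v`, the integers `b' = duβ₁`,
`c' = dβ₀` are `≡ 1 (mod 𝔪)`, their Artin lifts have `κ = b'_v⁻¹`, `c'_v⁻¹` (`rayAdicCharacter_eq_integerUnit_inv`), and
`(g₀⁻¹g)·σ_{c'}·σ_{b'}⁻¹` fixes every `K(𝔪vⁿ)`. [cite: deShalit1987, II.1.7 (p. 41), II.4.12 (p. 66–68)] [cite: NeukirchANT1999, Ch. VI §7 Thm. (7.1)] -/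
theorem rayAdicCharacter_inv_mul_mul_integerUnit_eq {β₀ β₁ : 𝓞 K}
    (hβ₀0 : β₀ ≠ 0) (hβ₀c : IsCoprime (Ideal.span {β₀}) 𝔪) (hβ₀v : β₀ ∉ v.asIdeal)
    (hβ₁0 : β₁ ≠ 0) (hβ₁c : IsCoprime (Ideal.span {β₁}) 𝔪) (hβ₁v : β₁ ∉ v.asIdeal)
    {g₀ g : absoluteGaloisGroup K}
    (hg₀ : ∀ n : ℕ, absRestrictNormalHom (rayClassField K (𝔪 * v.asIdeal ^ n)) g₀ =
      artinSymbol (galFrob K (rayClassField K (𝔪 * v.asIdeal ^ n))) (Ideal.span {β₀}))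
    (hg : ∀ n : ℕ, absRestrictNormalHom (rayClassField K (𝔪 * v.asIdeal ^ n)) g =
      artinSymbol (galFrob K (rayClassField K (𝔪 * v.asIdeal ^ n))) (Ideal.span {β₁}))
    (heq : absRestrictNormalHom (rayClassField K 𝔪) g₀ = absRestrictNormalHom (rayClassField K 𝔪) g) :
    ∃ (hmem : g₀⁻¹ * g ∈ (absRestrictNormalHom (rayClassField K 𝔪)).ker) (u : (𝓞 K)ˣ) (hu : (u : 𝓞 K) ∉ v.asIdeal),
      rayAdicCharacter h𝔪 hv hw ⟨g₀⁻¹ * g, hmem⟩ * integerUnit v β₁ hβ₁v * integerUnit v (u : 𝓞 K) hu =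
        integerUnit v β₀ hβ₀v := by
  have hmem : g₀⁻¹ * g ∈ (absRestrictNormalHom (rayClassField K 𝔪)).ker := by
    rw [MonoidHom.mem_ker, map_mul, map_inv, heq, inv_mul_cancel]
  -- the Artin symbols of `(β₀)`, `(β₁)` agree on `K(𝔪)`
  have hA : artinSymbol (galFrob K (rayClassField K 𝔪)) (Ideal.span {β₀}) =
      artinSymbol (galFrob K (rayClassField K 𝔪)) (Ideal.span {β₁}) := by
    have h0 := hg₀ 0
    have h1 := hg 0
    rw [pow_zero, mul_one] at h0 h1
    rw [← h0, ← h1, heq]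
  obtain ⟨u, hu𝔪⟩ := exists_unit_sub_mul_mem_of_artinSymbol_eq h𝔪 hβ₀0 hβ₀c hβ₁0 hβ₁c hA
  have huv : (u : 𝓞 K) ∉ v.asIdeal := fun h => v.isPrime.ne_top (Ideal.eq_top_of_isUnit_mem _ h u.isUnit)
  -- an inverse `d` of `β₀` modulo `𝔪` with `d ∉ v`; `b' = duβ₁ ≡ 1`, `c' = dβ₀ ≡ 1`
  obtain ⟨d, hd𝔪, hdv⟩ := exists_mul_sub_one_mem_and_not_mem hv hβ₀c
  have hd0 : d ≠ 0 := by rintro rfl; exact hdv v.asIdeal.zero_mem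
  have hb'1 : d * ((u : 𝓞 K) * β₁) - 1 ∈ 𝔪 := by
    have : d * ((u : 𝓞 K) * β₁) - 1 = (d * β₀ - 1) - d * (β₀ - u * β₁) := by ring
    rw [this]; exact 𝔪.sub_mem hd𝔪 (𝔪.mul_mem_left _ hu𝔪)
  have hb'0 : d * ((u : 𝓞 K) * β₁) ≠ 0 := mul_ne_zero hd0 (mul_ne_zero u.ne_zero hβ₁0)
  have hc'0 : d * β₀ ≠ 0 := mul_ne_zero hd0 hβ₀0
  have huβ₁v : (u : 𝓞 K) * β₁ ∉ v.asIdeal := mul_not_mem huv hβ₁v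
  have hb'v : d * ((u : 𝓞 K) * β₁) ∉ v.asIdeal := mul_not_mem hdv huβ₁v
  have hc'v : d * β₀ ∉ v.asIdeal := mul_not_mem hdv hβ₀v
  -- Artin lifts of `(b')`, `(c')` and their `κ`
  obtain ⟨σb, hσb⟩ := exists_forall_absRestrictNormalHom_eq_artinHom_span_singleton h𝔪 hv hb'0 hb'1 hb'v
  obtain ⟨σc, hσc⟩ := exists_forall_absRestrictNormalHom_eq_artinHom_span_singleton h𝔪 hv hc'0 hd𝔪 hc'v
  have hσbmem := mem_ker_of_forall_absRestrictNormalHom_eq_artinHom h𝔪 hv hb'0 hb'1 hb'v hσb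
  have hσcmem := mem_ker_of_forall_absRestrictNormalHom_eq_artinHom h𝔪 hv hc'0 hd𝔪 hc'v hσc
  have hκb := rayAdicCharacter_eq_integerUnit_inv h𝔪 hv hw hb'0 hb'1 hb'v hσb
  have hκc := rayAdicCharacter_eq_integerUnit_inv h𝔪 hv hw hc'0 hd𝔪 hc'v hσc
  -- `ρ := (g₀⁻¹g)·σ_{c'}·σ_{b'}⁻¹` fixes every layer `K(𝔪vⁿ)`
  have hd0' : Ideal.span {d} ≠ ⊥ := by simpa [Ideal.span_singleton_eq_bot] using hd0
  have hβ₀0' : Ideal.span {β₀} ≠ ⊥ := by simpa [Ideal.span_singleton_eq_bot] using hβ₀0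
  have hβ₁0' : Ideal.span {β₁} ≠ ⊥ := by simpa [Ideal.span_singleton_eq_bot] using hβ₁0
  have hρ : ∀ n : ℕ, g₀⁻¹ * g * σc * σb⁻¹ ∈ (absRestrictNormalHom (rayClassField K (𝔪 * v.asIdeal ^ n))).ker := by
    intro n
    rw [MonoidHom.mem_ker, map_mul, map_inv, mul_inv_eq_one, map_mul, map_mul, map_inv, hg₀ n, hg n, hσb n, hσc n,
      artinHom_toPrincipalIdeal_coe _ hb'0, artinHom_toPrincipalIdeal_coe _ hc'0,
      show (Ideal.span {d * ((u : 𝓞 K) * β₁)} : Ideal (𝓞 K)) = Ideal.span {d} * Ideal.span {β₁} by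
        rw [← Ideal.span_singleton_mul_span_singleton, Ideal.span_singleton_mul_left_unit u.isUnit],
      show (Ideal.span {d * β₀} : Ideal (𝓞 K)) = Ideal.span {d} * Ideal.span {β₀} by
        rw [Ideal.span_singleton_mul_span_singleton],
      artinSymbol_mul _ hd0' hβ₁0', artinSymbol_mul _ hd0' hβ₀0',
      mul_comm (artinSymbol _ (Ideal.span {d})) (artinSymbol _ (Ideal.span {β₀})), mul_mul_mul_comm,
      inv_mul_cancel, one_mul]
    exact mul_comm _ _
  -- in the group `Gal(K̄/K(𝔪))`
  set G₁ : ↥(absRestrictNormalHom (rayClassField K 𝔪)).ker := ⟨g₀⁻¹ * g, hmem⟩ with hG₁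
  set Sb : ↥(absRestrictNormalHom (rayClassField K 𝔪)).ker := ⟨σb, hσbmem⟩ with hSb
  set Sc : ↥(absRestrictNormalHom (rayClassField K 𝔪)).ker := ⟨σc, hσcmem⟩ with hSc
  have hκρ : rayAdicCharacter h𝔪 hv hw (G₁ * Sc * Sb⁻¹) = 1 :=
    rayAdicCharacter_eq_one_of_forall_mem_ker h𝔪 hv hw _ hρ
  have e1 : G₁ * Sc = (G₁ * Sc * Sb⁻¹) * Sb := by group
  have e2 : rayAdicCharacter h𝔪 hv hw G₁ * rayAdicCharacter h𝔪 hv hw Sc = rayAdicCharacter h𝔪 hv hw Sb := by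
    rw [← map_mul, e1, map_mul, hκρ, one_mul]
  -- `e2 : b'_v · κ G₁ = c'_v`, i.e. `d_v u_v β₁,v κ G₁ = d_v β₀,v`; cancel `d_v` and commute in `𝒪_vˣ`
  rw [hκb, hκc, mul_inv_eq_iff_eq_mul, eq_inv_mul_iff_mul_eq, integerUnit_mul v hdv huβ₁v hb'v,
    integerUnit_mul v huv hβ₁v huβ₁v, integerUnit_mul v hdv hβ₀v hc'v, mul_assoc, mul_assoc] at e2
  have e3 := mul_left_cancel e2
  refine ⟨hmem, u, huv, ?_⟩
  calc rayAdicCharacter h𝔪 hv hw G₁ * integerUnit v β₁ hβ₁v * integerUnit v (u : 𝓞 K) huv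
      = integerUnit v (u : 𝓞 K) huv * (integerUnit v β₁ hβ₁v * rayAdicCharacter h𝔪 hv hw G₁) := by
        simp only [mul_comm, mul_left_comm]
    _ = integerUnit v β₀ hβ₀v := e3

end Key

/-! ### §3. The constant `U_τ`: `κ_𝔪(τg)·β_v = ζ_v·U_τ` at every level below a reference modulus -/

section Constant

variable [IsTotallyComplex K] {v : HeightOneSpectrum (𝓞 K)} {𝔪₀ : Ideal (𝓞 K)}
  (h𝔪₀ : 𝔪₀ ≠ ⊥) (hv₀ : ¬ 𝔪₀ ≤ v.asIdeal) (hw₀ : ∀ u : (𝓞 K)ˣ, (u : 𝓞 K) - 1 ∈ 𝔪₀ → u = 1)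

omit [NumberField K] [IsTotallyComplex K] in
/-- `(β)` prime to `𝔪·v` with `𝔪·v ≠ (1)`: `β ≠ 0`. [folklore] -/
private theorem ne_zero_of_isCoprime_span_mul {𝔪 : Ideal (𝓞 K)} {β : 𝓞 K} (h : IsCoprime (Ideal.span {β}) (𝔪 * v.asIdeal)) :
    β ≠ 0 := by
  rintro rfl
  rw [Ideal.span_singleton_eq_bot.mpr rfl, Ideal.isCoprime_iff_sup_eq, bot_sup_eq] at h
  exact v.isPrime.ne_top (top_le_iff.mp (h ▸ Ideal.mul_le_left))

include h𝔪₀ hv₀ hw₀ in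
/-- ★★★ **The constant `U_τ`.**  `K` totally complex of class number one, `v` a finite prime, `𝔪₀ ≠ 0` a reference modulus with
`v ∤ 𝔪₀`, `w_{𝔪₀} = 1`, `τ ∈ Γ_K`.  There is `U ∈ 𝒪_vˣ` such that for EVERY modulus `𝔪 ⊆ 𝔪₀` (`𝔪 ≠ 0`, `v ∤ 𝔪`, `w_𝔪 = 1`), every
integer `β` prime to `𝔪v` with `((β), K(𝔪)/K) = τ⁻¹|_{K(𝔪)}`, and every `g ∈ Γ_K` restricting to `((β), K(𝔪v^{n+1})/K)` on the whole
`v`-tower: `τ·g ∈ Gal(K̄/K(𝔪))` and **`κ_𝔪(τ·g)·β_v·ζ_v = U` for some global unit `ζ ∈ 𝓞_Kˣ`**.  (`U := κ_{𝔪₀}(τ·g₀)·β₀,v` for a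
reference principal ideal `(β₀)` with the same Artin symbol and its universal Artin lift `g₀`; then §2 and `rayAdicCharacter_eq_of_le`.)
This is the hypothesis (U) = [I3] of the `j = 0` seam of cell `bsd-print-cf2` (de Shalit II.4.14 (38)→(40): the `τ`-unit absorbed
into the period `Ω_p`). [cite: deShalit1987, II.4.7 (16) (p. 60), II.4.12 (p. 66–68), II.4.14 (38)–(40) (p. 71–72)]
[cite: NeukirchANT1999, Ch. VI §7 Thm. (7.1)] -/
theorem exists_unit_forall_rayAdicCharacter_mul_integerUnit_eq (hh : NumberField.classNumber K = 1) (τ : absoluteGaloisGroup K) :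
    ∃ U : (v.adicCompletionIntegers K)ˣ, ∀ (𝔪 : Ideal (𝓞 K)) (h𝔪 : 𝔪 ≠ ⊥) (hv : ¬ 𝔪 ≤ v.asIdeal)
      (hw : ∀ u : (𝓞 K)ˣ, (u : 𝓞 K) - 1 ∈ 𝔪 → u = 1) (_hle : 𝔪 ≤ 𝔪₀) (β : 𝓞 K)
      (_hβ : IsCoprime (Ideal.span {β}) (𝔪 * v.asIdeal)) (g : absoluteGaloisGroup K)
      (_hg : ∀ n : ℕ, absRestrictNormalHom (rayClassField K (𝔪 * v.asIdeal ^ (n + 1))) g =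
        artinSymbol (galFrob K (rayClassField K (𝔪 * v.asIdeal ^ (n + 1)))) (Ideal.span {β}))
      (_hτ : absRestrictNormalHom (rayClassField K 𝔪) τ⁻¹ = artinSymbol (galFrob K (rayClassField K 𝔪)) (Ideal.span {β})),
      ∃ (hβv : β ∉ v.asIdeal) (hτg : τ * g ∈ (absRestrictNormalHom (rayClassField K 𝔪)).ker) (ζ : (𝓞 K)ˣ)
        (hζ : (ζ : 𝓞 K) ∉ v.asIdeal),
        rayAdicCharacter h𝔪 hv hw ⟨τ * g, hτg⟩ * integerUnit v β hβv * integerUnit v (ζ : 𝓞 K) hζ = U := by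
  haveI : IsPrincipalIdealRing (𝓞 K) := (NumberField.classNumber_eq_one_iff (K := K)).mp hh
  have h𝔪₀v : 𝔪₀ * v.asIdeal ≠ ⊥ := mul_ne_zero h𝔪₀ v.ne_bot
  -- the reference principal ideal `(β₀)` with `((β₀), K(𝔪₀v)/K) = τ⁻¹|`
  obtain ⟨𝔞, h𝔞0, h𝔞c, h𝔞τ⟩ := exists_ideal_artinSymbol_eq_absRestrictNormalHom h𝔪₀v τ⁻¹
  obtain ⟨β₀, hβ₀⟩ := (IsPrincipalIdealRing.principal 𝔞).principal
  change 𝔞 = Ideal.span {β₀} at hβ₀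
  subst hβ₀
  have hβ₀0 : β₀ ≠ 0 := by simpa [Ideal.span_singleton_eq_bot] using h𝔞0
  have hβ₀c : IsCoprime (Ideal.span {β₀}) 𝔪₀ := h𝔞c.of_mul_right_left
  have hβ₀cv : IsCoprime (Ideal.span {β₀}) v.asIdeal := h𝔞c.of_mul_right_right
  have hβ₀v : β₀ ∉ v.asIdeal := not_mem_of_isCoprime_span_mul h𝔞c
  have hτ₀ : absRestrictNormalHom (rayClassField K 𝔪₀) τ⁻¹ = artinSymbol (galFrob K (rayClassField K 𝔪₀)) (Ideal.span {β₀}) :=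
    absRestrictNormalHom_eq_artinSymbol_of_le h𝔪₀v h𝔪₀ Ideal.mul_le_right hβ₀0 h𝔞c h𝔞τ.symm
  -- its universal Artin lift `g₀`
  obtain ⟨g₀, hg₀⟩ := exists_forall_absRestrictNormalHom_eq_artinHom (K := K)
    (toPrincipalIdeal (𝓞 K) K (Units.mk0 (β₀ : K) (by exact_mod_cast hβ₀0)))
  have hg₀' : ∀ n : ℕ, absRestrictNormalHom (rayClassField K (𝔪₀ * v.asIdeal ^ n)) g₀ =
      artinSymbol (galFrob K (rayClassField K (𝔪₀ * v.asIdeal ^ n))) (Ideal.span {β₀}) := by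
    intro n
    have hmem : toPrincipalIdeal (𝓞 K) K (Units.mk0 (β₀ : K) (by exact_mod_cast hβ₀0)) ∈ idealsPrimeTo (𝔪₀ * v.asIdeal ^ n) := by
      rw [toPrincipalIdeal_unitsMk0_coe hβ₀0]
      exact unitsMk0_coeIdeal_mem_idealsPrimeTo (mul_ne_zero h𝔪₀ (pow_ne_zero _ v.ne_bot)) h𝔞0
        (hβ₀c.mul_right hβ₀cv.pow_right)
    rw [hg₀ _ (mul_ne_zero h𝔪₀ (pow_ne_zero _ v.ne_bot)) hmem, artinHom_toPrincipalIdeal_coe _ hβ₀0]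
  have hτg₀ : τ * g₀ ∈ (absRestrictNormalHom (rayClassField K 𝔪₀)).ker := by
    have h0 := hg₀' 0
    rw [pow_zero, mul_one] at h0
    rw [MonoidHom.mem_ker, map_mul, h0, ← hτ₀, map_inv, mul_inv_cancel]
  refine ⟨rayAdicCharacter h𝔪₀ hv₀ hw₀ ⟨τ * g₀, hτg₀⟩ * integerUnit v β₀ hβ₀v, ?_⟩
  intro 𝔪 h𝔪 hv hw hle β hβ g hg hτ
  have hβ0 : β ≠ 0 := ne_zero_of_isCoprime_span_mul hβ
  have hβc : IsCoprime (Ideal.span {β}) 𝔪 := hβ.of_mul_right_left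
  have hβcv : IsCoprime (Ideal.span {β}) v.asIdeal := hβ.of_mul_right_right
  have hβv : β ∉ v.asIdeal := not_mem_of_isCoprime_span_mul hβ
  have hβc₀ : IsCoprime (Ideal.span {β}) 𝔪₀ := isCoprime_of_le hβc hle
  -- `g` and `τ⁻¹` read on the reference tower
  have hg' : ∀ n : ℕ, absRestrictNormalHom (rayClassField K (𝔪₀ * v.asIdeal ^ n)) g =
      artinSymbol (galFrob K (rayClassField K (𝔪₀ * v.asIdeal ^ n))) (Ideal.span {β}) := fun n =>
    absRestrictNormalHom_eq_artinSymbol_of_le (mul_ne_zero h𝔪 (pow_ne_zero _ v.ne_bot))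
      (mul_ne_zero h𝔪₀ (pow_ne_zero _ v.ne_bot)) (Ideal.mul_mono hle (Ideal.pow_le_pow_right (Nat.le_succ n))) hβ0
      (hβc.mul_right hβcv.pow_right) (hg n)
  have hτ' : absRestrictNormalHom (rayClassField K 𝔪₀) τ⁻¹ = artinSymbol (galFrob K (rayClassField K 𝔪₀)) (Ideal.span {β}) :=
    absRestrictNormalHom_eq_artinSymbol_of_le h𝔪 h𝔪₀ hle hβ0 hβc hτ
  have heq : absRestrictNormalHom (rayClassField K 𝔪₀) g₀ = absRestrictNormalHom (rayClassField K 𝔪₀) g := by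
    have a := hg₀' 0
    have b := hg' 0
    rw [pow_zero, mul_one] at a b
    rw [a, b, ← hτ₀, hτ']
  obtain ⟨hmem, u, hu, hkey⟩ := rayAdicCharacter_inv_mul_mul_integerUnit_eq h𝔪₀ hv₀ hw₀ hβ₀0 hβ₀c hβ₀v hβ0 hβc₀ hβv
    hg₀' hg' heq
  -- `τg ∈ Gal(K̄/K(𝔪))`
  have hgres : absRestrictNormalHom (rayClassField K 𝔪) g = artinSymbol (galFrob K (rayClassField K 𝔪)) (Ideal.span {β}) :=
    absRestrictNormalHom_eq_artinSymbol_of_le (mul_ne_zero h𝔪 (pow_ne_zero _ v.ne_bot)) h𝔪 Ideal.mul_le_right hβ0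
      (hβc.mul_right hβcv.pow_right) (hg 0)
  have hτg : τ * g ∈ (absRestrictNormalHom (rayClassField K 𝔪)).ker := by
    rw [MonoidHom.mem_ker, map_mul, hgres, ← hτ, map_inv, mul_inv_cancel]
  refine ⟨hβv, hτg, u, hu, ?_⟩
  -- read `κ_𝔪(τg)` on the reference modulus and split `τg = (τg₀)·(g₀⁻¹g)`
  rw [← rayAdicCharacter_eq_of_le h𝔪₀ hv₀ hw₀ h𝔪 hle hv hw ⟨τ * g, hτg⟩,
    show (⟨τ * g, ker_absRestrictNormalHom_rayClassField_anti h𝔪 hle hτg⟩ : ↥(absRestrictNormalHom (rayClassField K 𝔪₀)).ker) =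
      ⟨τ * g₀, hτg₀⟩ * ⟨g₀⁻¹ * g, hmem⟩ from Subtype.ext (by simp only [Subgroup.coe_mul]; group),
    map_mul]
  calc rayAdicCharacter h𝔪₀ hv₀ hw₀ ⟨τ * g₀, hτg₀⟩ * rayAdicCharacter h𝔪₀ hv₀ hw₀ ⟨g₀⁻¹ * g, hmem⟩ * integerUnit v β hβv *
        integerUnit v (u : 𝓞 K) hu
      = rayAdicCharacter h𝔪₀ hv₀ hw₀ ⟨τ * g₀, hτg₀⟩ *
          (rayAdicCharacter h𝔪₀ hv₀ hw₀ ⟨g₀⁻¹ * g, hmem⟩ * integerUnit v β hβv * integerUnit v (u : 𝓞 K) hu) := by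
        simp only [mul_assoc]
    _ = rayAdicCharacter h𝔪₀ hv₀ hw₀ ⟨τ * g₀, hτg₀⟩ * integerUnit v β₀ hβ₀v := by rw [hkey]

omit h𝔪₀ hv₀ hw₀ in
/-- ★★★ **(U) at the frame of the `j = 0` seam**: the reference modulus `𝔪₀ := v̄²` for two distinct primes `v ≠ v̄` with `w_{v̄²} = 1`
(the frame's `hw2`; at `K = ℚ(√−7)`, `2 = v v̄`): for every `τ ∈ Γ_K` there is `U ∈ 𝒪_vˣ` with `κ_𝔪(τ·g)·β_v·ζ_v = U` (`ζ ∈ 𝓞_Kˣ`) at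
EVERY lane modulus `𝔪 ⊆ v̄²` (all `𝔪_M = ∏_{w ∈ S ∪ {v̄}} w^{M+1}`, `M ≥ 1`, every tame set `S`), every admissible `β` and every
Artin lift `g`. [cite: deShalit1987, II.4.14 (38)–(40) (p. 71–72), II.4.17 (p. 77–78)] [cite: NeukirchANT1999, Ch. VI §7 Thm. (7.1)] -/
theorem exists_unit_forall_rayAdicCharacter_mul_integerUnit_eq_of_sq (hh : NumberField.classNumber K = 1)
    {vbar : HeightOneSpectrum (𝓞 K)} (hne : vbar ≠ v) (hw2 : ∀ u : (𝓞 K)ˣ, (u : 𝓞 K) - 1 ∈ vbar.asIdeal ^ 2 → u = 1)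
    (τ : absoluteGaloisGroup K) :
    ∃ U : (v.adicCompletionIntegers K)ˣ, ∀ (𝔪 : Ideal (𝓞 K)) (h𝔪 : 𝔪 ≠ ⊥) (hv : ¬ 𝔪 ≤ v.asIdeal)
      (hw : ∀ u : (𝓞 K)ˣ, (u : 𝓞 K) - 1 ∈ 𝔪 → u = 1) (_hle : 𝔪 ≤ vbar.asIdeal ^ 2) (β : 𝓞 K)
      (_hβ : IsCoprime (Ideal.span {β}) (𝔪 * v.asIdeal)) (g : absoluteGaloisGroup K)
      (_hg : ∀ n : ℕ, absRestrictNormalHom (rayClassField K (𝔪 * v.asIdeal ^ (n + 1))) g =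
        artinSymbol (galFrob K (rayClassField K (𝔪 * v.asIdeal ^ (n + 1)))) (Ideal.span {β}))
      (_hτ : absRestrictNormalHom (rayClassField K 𝔪) τ⁻¹ = artinSymbol (galFrob K (rayClassField K 𝔪)) (Ideal.span {β})),
      ∃ (hβv : β ∉ v.asIdeal) (hτg : τ * g ∈ (absRestrictNormalHom (rayClassField K 𝔪)).ker) (ζ : (𝓞 K)ˣ)
        (hζ : (ζ : 𝓞 K) ∉ v.asIdeal),
        rayAdicCharacter h𝔪 hv hw ⟨τ * g, hτg⟩ * integerUnit v β hβv * integerUnit v (ζ : 𝓞 K) hζ = U := by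
  have hv₀ : ¬ vbar.asIdeal ^ 2 ≤ v.asIdeal := fun h =>
    hne (HeightOneSpectrum.ext (vbar.isMaximal.eq_of_le v.isPrime.ne_top
      ((Ideal.IsPrime.pow_le_iff (I := vbar.asIdeal) two_ne_zero).mp h)))
  exact exists_unit_forall_rayAdicCharacter_mul_integerUnit_eq (pow_ne_zero 2 vbar.ne_bot) hv₀ hw2 hh τ

end Constant

end Literature.NumberTheory.NumberFields

end
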